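import Mathlib
import Summits.NavierStokesRegularity.NavierStokesRegularity.Theorems.LerayQuarterDissipationFiniteDissipationLiouvilleTrapping
import Summits.NavierStokesRegularity.NavierStokesRegularity.Theorems.LerayQuarterDissipationFiniteDissipationLiouvilleSubthreshold
import HarnessLib

/-!
# Crux `FiniteDissipationLiouville` (stmt-NavierStokesRegularity-22144): THE EVERY-INSTANT ENSTROPHY
# FLOOR — the hypothetical singular profile never dips below the explicit dissipation threshold

Theorems file of route `LerayQuarterDissipation` (lead prover g17; `--supports` the crux; portrait
fact for the registered stub `stub_envelopeCriticalLiouville` of skeleton `Lines/birth.lean`;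
sequel of `…TrappingTools` / `…Trapping`). Navier–Stokes regularity is NOT proved by anything here;
no summit is.

`𝒟_{C,K}`: Type-I ancient mild fields `V` in the KNSS gauge with Leray's quarter-rate law
`∫‖DV(t)‖² ≤ K/√(−t)`; `Z(s) = ∫‖Ω(s)‖² = √(−t)∫‖curl V(t)‖²dx` the global similarity enstrophy
(`t = −e^{−s}`); `K_S` Mathlib's Gagliardo–Nirenberg–Sobolev constant. TWO MECHANISMS COMBINED:
FORWARD INVARIANCE (`…Trapping`: below the explicit threshold `K_S⁶Z² < 64/27` — the number of the
all-time rung `θ(K)⁴ < 64/27` — the enstrophy can only decrease, so the law holds with the smaller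
constant `Z(s₀)` from that instant on) and BACKWARD COMPACTNESS AT THE APEX (`…Subthreshold`,
ns-lqd-p1: orbit limits along scales `l_k → 0` inherit an eventual law by Fatou; singularities
persist along the orbit, Albritton–Barker):

* `notSingular_of_subthreshold_along_scales_explicit` — `…Subthreshold.notSingular_of_subthreshold_along_scales`
  with its existential gap constant replaced by the EXPLICIT rung of `…SmallDissipationGapSharper`;
* **`not_singular_of_subthreshold_instant` — ONE instant with `(√Z(s₀)·(√K_S)³)⁴ < 64/27` forces
  regularity at the apex** (the one-instant leaf `…QuietSliceAbsolute.quietSlice_leaf_absolute` of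
  ns-lqd-p2 has an ABSOLUTE but existential threshold `δ₀`; here the threshold is the explicit one of
  the all-time rung — `sup_t` is replaced by `∃ t` at no cost in the constant);
* **`enstrophy_floor_of_singular`** / **`vorticity_floor_of_singular`** — **THE EVERY-INSTANT FLOOR:
  a singular member of the stratum has `K_S⁶(√(−t)∫‖ω(t)‖²dx)² ≥ 64/27` at EVERY instant `t < 0`**,
  i.e. `∫‖ω(t)‖²dx ≥ (64/27)^{1/2}K_S^{−3}/√(−t)` — two-sided with the law
  (`≤ ‖curl‖²K/√(−t)`), Leray's 1934 lower bound on the blow-up rate of the enstrophy in the ancient,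
  scale-invariant, explicit form: no excursion of the dimensionless enstrophy below the threshold,
  ever (the window floors of lead g15/g16 allowed excursions between long log-windows).

HONEST FRAMING. Explicit necessary condition on a HYPOTHETICAL object (Mathlib's non-sharp `K_S`;
the scales/persistence step is qualitative but enters no constant). Nothing is removed from the
catalogued DSS wall (`∀ c > 1, TypeIDSSLiouville c`, NECESSARY for the crux); verdict of the line
unchanged (FRONTIER). Nothing here bears on Navier–Stokes regularity or blow-up.

References: J. Leray, Acta Math. 63 (1934) §§19–20; J. C. Robinson, J. L. Rodrigo, W. Sadowski, *The
three-dimensional Navier–Stokes equations* (CUP 2016), Lemma 6.11 (Leray's rate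
`‖∇u(t)‖² ≥ c'/√(T*−t)`) and Thm 6.12 (the small-enstrophy invariant region on bounded domains,
damping by Poincaré — here transplanted to similarity variables on `ℝ³`, damping by the scaling
term); Koch–Nadirashvili–Seregin–Šverák, Acta Math. 203 (2009) §§4, 6; Albritton–Barker,
arXiv:1811.00502, Prop. 2.3.
-/

noncomputable section

set_option linter.dupNamespace false

namespace Summit.NavierStokesRegularity.NavierStokesRegularity.Theorems.FiniteDissipationLiouville.EveryInstant

open MeasureTheory Set Filter Topology Metric InnerProductSpace Function Real
open scoped RealInnerProductSpace ContDiff ENNReal Laplacian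
open Literature.Analysis Literature.Analysis.FluidPDE
open Summit.NavierStokesRegularity.NavierStokesRegularity.Theorems
open Summit.NavierStokesRegularity.NavierStokesRegularity.Theorems.GaussianGap
open Summit.NavierStokesRegularity.NavierStokesRegularity.Theorems.SimilarityEnstrophy
open Summit.NavierStokesRegularity.NavierStokesRegularity.Theorems.SmallDissipationGap
open Summit.NavierStokesRegularity.NavierStokesRegularity.Theorems.FiniteDissipationLiouville.Trapping

variable {C : ℝ} {V : ℝ → (EuclideanSpace ℝ (Fin 3)) → (EuclideanSpace ℝ (Fin 3))}

section EveryInstant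

/-- **The sub-threshold leaf along scales, EXPLICIT constant** (`…Subthreshold.notSingular_of_subthreshold_along_scales`
of ns-lqd-p1 with its existential gap constant replaced by the explicit rung
`…SmallDissipationGap.eq_zero_of_small_dissipation_sharper`): if a member of the stratum admits scales
`l_k > 0` with `√(−l_k²s)∫‖∇u(l_k²s)‖² ≤ K₁` eventually in `k`, for every fixed `s < 0`, where
`(√(max K₁ 0)·(√K_S)³)⁴ < 64/27`, then it is bounded on some backward cylinder at the origin (orbit
limit with the law `K₁` ⇒ zero by the rung; persistence of the singularity). [folklore energy method] -/
theorem notSingular_of_subthreshold_along_scales_explicit {C K K₁ : ℝ}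
    {u : ℝ → EuclideanSpace ℝ (Fin 3) → EuclideanSpace ℝ (Fin 3)}
    (hK₁ : (Real.sqrt (max K₁ 0) * Real.sqrt (SNormLESNormFDerivOfEqConst (EuclideanSpace ℝ (Fin 3))
        (volume : Measure (EuclideanSpace ℝ (Fin 3))) 2 : ℝ) ^ 3) ^ 4 < 64 / 27)
    (hu : IsTypeIAncientMild C u)
    (hlaw : ∀ s : ℝ, s < 0 → ∫⁻ x, ‖fderiv ℝ (u s) x‖ₑ ^ 2 ≤ ENNReal.ofReal (K / Real.sqrt (-s)))
    (hsc : ∃ l : ℕ → ℝ, (∀ k, 0 < l k) ∧ ∀ s : ℝ, s < 0 → ∀ᶠ k in atTop,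
        ∫⁻ x, ‖fderiv ℝ (u (l k ^ 2 * s)) x‖ₑ ^ 2 ≤
          ENNReal.ofReal (K₁ / Real.sqrt (-(l k ^ 2 * s)))) :
    ¬ (∀ r > 0, ∀ M : ℝ, ∃ t ∈ Set.Ioo (-(r ^ 2)) (0 : ℝ),
        ∃ x ∈ Metric.ball (0 : EuclideanSpace ℝ (Fin 3)) r, M < ‖u t x‖) := by
  obtain ⟨l, hl, hwin⟩ := hsc
  intro hsing
  have hwin' : ∀ s : ℝ, s < 0 → ∀ᶠ k in atTop,
      ∫⁻ x, ‖fderiv ℝ (nsRescale (l k) u s) x‖ₑ ^ 2 ≤ ENNReal.ofReal (K₁ / Real.sqrt (-s)) :=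
    fun s hs => (hwin s hs).mono fun k hk => Subthreshold.law_nsRescale_of_law_at (hl k) hs hk
  obtain ⟨ψ, -, W, hW, hlawW, hunif, -⟩ :=
    Subthreshold.exists_orbitLimit_of_eventually_law hu hlaw l hl hwin'
  have hz : ∀ t < 0, ∀ x, W t x = 0 := eq_zero_of_small_dissipation_sharper hW hlawW hK₁
  have hWsing := RecurrentReductionD.persistent_singularity hu hlaw hsing (fun j => l (ψ j))
    (fun j => hl _) W hunif
  obtain ⟨t, ht, x, -, hM⟩ := hWsing 1 one_pos 0
  rw [hz t ht.2 x, norm_zero] at hM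
  exact lt_irrefl 0 hM

/-- **ONE SUB-THRESHOLD INSTANT FORCES REGULARITY (explicit threshold = the all-time rung's).**
A member `V` of `𝒟_{C,K}` (any `C`, `K`) whose global similarity enstrophy satisfies
`(√Z(s₀)·(√K_S)³)⁴ < 64/27` at ONE instant `s₀` is bounded on some backward parabolic cylinder at the
space-time origin: by the trapping the law holds with constant `Z(s₀)` from `t₀ = −e^{−s₀}` on, so
along any scales `l_k → 0` the rescaled laws hold with `Z(s₀)` eventually, and the explicit
sub-threshold leaf applies. Compare `…QuietSliceAbsolute.quietSlice_leaf_absolute` (one quiet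
instant, ABSOLUTE but existential threshold `δ₀`) and the all-time rung
`…SmallDissipationGapSharper` (`sup_t` below `64/27`). [folklore energy method] -/
theorem not_singular_of_subthreshold_instant (hV : IsTypeIAncientMild C V) {K : ℝ}
    (hK : ∀ t : ℝ, t < 0 → ∫⁻ x, ‖fderiv ℝ (V t) x‖ₑ ^ 2 ≤ ENNReal.ofReal (K / Real.sqrt (-t)))
    {s₀ : ℝ}
    (h0 : (Real.sqrt (∫ y, ‖lerayVorticity V s₀ y‖ ^ 2) * Real.sqrt (SNormLESNormFDerivOfEqConst (EuclideanSpace ℝ (Fin 3))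
        (volume : Measure (EuclideanSpace ℝ (Fin 3))) 2 : ℝ) ^ 3) ^ 4 < 64 / 27) :
    ¬ (∀ r > 0, ∀ M : ℝ, ∃ t ∈ Set.Ioo (-(r ^ 2)) (0 : ℝ),
        ∃ x ∈ Metric.ball (0 : EuclideanSpace ℝ (Fin 3)) r, M < ‖V t x‖) := by
  set z₀ : ℝ := ∫ y, ‖lerayVorticity V s₀ y‖ ^ 2 with hz₀
  have hz0 : 0 ≤ z₀ := integral_nonneg fun y => sq_nonneg _
  have hlaw := law_from_of_trapping hV hK h0
  refine notSingular_of_subthreshold_along_scales_explicit (K₁ := z₀)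
    (by rw [max_eq_left hz0]; exact h0) hV hK ⟨fun k => 1 / ((k : ℝ) + 1), fun k => by positivity, ?_⟩
  intro s hs
  -- eventually `t₀ ≤ l_k² s < 0`
  have hT : Tendsto (fun k : ℕ => (1 / ((k : ℝ) + 1)) ^ 2 * s) atTop (𝓝 (0 * s)) := by
    refine Tendsto.mul_const s ?_
    have h := (tendsto_one_div_add_atTop_nhds_zero_nat (𝕜 := ℝ)).pow 2
    simpa using h
  rw [zero_mul] at hT
  have hev : ∀ᶠ k : ℕ in atTop, -Real.exp (-s₀) < (1 / ((k : ℝ) + 1)) ^ 2 * s :=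
    hT.eventually (eventually_gt_nhds (neg_neg_of_pos (Real.exp_pos _)))
  filter_upwards [hev] with k hk
  have hneg : (1 / ((k : ℝ) + 1)) ^ 2 * s < 0 := mul_neg_of_pos_of_neg (by positivity) hs
  exact hlaw _ hk.le hneg

/-- **THE EVERY-INSTANT ENSTROPHY FLOOR (explicit).** A SINGULAR member of `𝒟_{C,K}` has
`(√Z(s)·(√K_S)³)⁴ ≥ 64/27`, i.e. `K_S⁶Z(s)² ≥ 64/27`, at EVERY instant `s` — the global similarity
enstrophy of the hypothetical blow-up profile never dips below the explicit threshold of the all-time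
rung, not even momentarily (no intermittency below the threshold). [folklore energy method] -/
theorem enstrophy_floor_of_singular (hV : IsTypeIAncientMild C V) {K : ℝ}
    (hK : ∀ t : ℝ, t < 0 → ∫⁻ x, ‖fderiv ℝ (V t) x‖ₑ ^ 2 ≤ ENNReal.ofReal (K / Real.sqrt (-t)))
    (hsing : ∀ r > 0, ∀ M : ℝ, ∃ t ∈ Set.Ioo (-(r ^ 2)) (0 : ℝ),
        ∃ x ∈ Metric.ball (0 : EuclideanSpace ℝ (Fin 3)) r, M < ‖V t x‖) (s : ℝ) :
    64 / 27 ≤ (Real.sqrt (∫ y, ‖lerayVorticity V s y‖ ^ 2) * Real.sqrt (SNormLESNormFDerivOfEqConst (EuclideanSpace ℝ (Fin 3))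
        (volume : Measure (EuclideanSpace ℝ (Fin 3))) 2 : ℝ) ^ 3) ^ 4 := by
  by_contra h
  push Not at h
  exact not_singular_of_subthreshold_instant hV hK h hsing

/-- **THE EVERY-INSTANT VORTICITY FLOOR, physical variables (Leray-type lower bound, explicit modulo
`K_S`).** A SINGULAR member of `𝒟_{C,K}` has, at EVERY instant `t < 0`,
`(√(√(−t)∫‖curl V(t)‖²dx)·(√K_S)³)⁴ ≥ 64/27`, i.e. `∫‖ω(t)‖²dx ≥ (64/27)^{1/2}K_S^{−3}/√(−t)`:
two-sided with the law, `(64/27)^{1/2}K_S^{−3} ≤ √(−t)∫‖ω(t)‖² ≤ ‖curl‖²K` at every instant.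
[folklore energy method; Leray 1934 §20] -/
theorem vorticity_floor_of_singular (hV : IsTypeIAncientMild C V) {K : ℝ}
    (hK : ∀ t : ℝ, t < 0 → ∫⁻ x, ‖fderiv ℝ (V t) x‖ₑ ^ 2 ≤ ENNReal.ofReal (K / Real.sqrt (-t)))
    (hsing : ∀ r > 0, ∀ M : ℝ, ∃ t ∈ Set.Ioo (-(r ^ 2)) (0 : ℝ),
        ∃ x ∈ Metric.ball (0 : EuclideanSpace ℝ (Fin 3)) r, M < ‖V t x‖) {t : ℝ} (ht : t < 0) :
    64 / 27 ≤ (Real.sqrt (Real.sqrt (-t) * ∫ x, ‖curl (V t) x‖ ^ 2) * Real.sqrt (SNormLESNormFDerivOfEqConst (EuclideanSpace ℝ (Fin 3))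
        (volume : Measure (EuclideanSpace ℝ (Fin 3))) 2 : ℝ) ^ 3) ^ 4 := by
  set s : ℝ := -Real.log (-t) with hs
  have hts : -Real.exp (-s) = t := by rw [hs, neg_neg, Real.exp_log (neg_pos.2 ht), neg_neg]
  have hsq : Real.exp (-s / 2) = Real.sqrt (-t) := by rw [← sqrt_exp_neg, ← neg_neg (Real.exp _), hts]
  have h := enstrophy_floor_of_singular hV hK hsing s
  rwa [integral_sq_norm_lerayVorticity_eq, hts, hsq] at h

end EveryInstant

end Summit.NavierStokesRegularity.NavierStokesRegularity.Theorems.FiniteDissipationLiouville.EveryInstant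

end
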